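import Literature.AlgebraicGeometry.AbelianSchemes.SerreCoverRowsAtPointOfIsoBaseChange   -- ★ p850783 (LA4-p01): the GLOBAL-iso version; re-exports ★ p850688 `coverKer_rows_readAt`, ★ `coverKer_transport_along_iso`, ★ `exists_iso_of_tupleRel_id`, ★ `tupleRel_baseChangeCompGrpIso_inv`
import Literature.AlgebraicGeometry.AbelianSchemes.TupleRelBaseChangeUnique         -- ★ p847561: `exists_tupleIsoVia_of_tupleRel` (a GLOBAL six-clause relation along `π` read at every point `t`)
import Literature.AlgebraicGeometry.AbelianSchemes.TupleRelSymm                     -- ★ `exists_tupleRel_id_symm` (the point relation is symmetric over a geometric point)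
import HarnessLib

/-!
# The GLOBAL Serre-cover rows of `c : 𝒜 → ℬ` over `Y`, with `ℬ` a PULL-BACK OF `𝒜₂` ALONG `π : Y → Y₂` AS PEL TUPLES (six-clause relation, no global iso,
# no connectedness of `Y`), READ AT A FIELD POINT `ℓ` as rows `𝒜_ℓ → (𝒜₂)_{ℓ ≫ π}`

Topic `AlgebraicGeometry/AbelianSchemes`; namespace `Literature.AlgebraicGeometry.AbelianSchemes.AbelianSchemeOver`.  THEOREMS ONLY (no definition,
no named fact, no instance, no notation, no `sorry`); universe-polymorphic.  Cell `hodgecm-mathlib` (D-0151), P6 «MOD programme» (crux hLiu418 =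
stmt-HodgeConjecture-24832, `--supports`, count-neutral), line «L4», ROAD OF RECORD (γ′) «Serre tensor OVER `X`, classified» (LA4-plan (g2) 2026-09-02
08:48:23Z ∕ DEAL #39 «GLOBAL ROWS ⇒ POINT ROWS»).  Sequel of ★ `coverKer_rows_readAt_of_iso_baseChange` (FILE 1, hypothesis = a GLOBAL exact ISOMORPHISM
`E : ℬ ≅ 𝒜₂ ×_{Y₂} π` of group schemes over `Y`).  Over the base of record `X = Sh_K ⊗_F Fᵢ` — reduced and locally Noetherian but in general NOT connected —
fine moduli ([MumfordFogartyKirwan1994] Ch. 7 §2–§3) deliver the twisted family `ℬ` only as a PULL-BACK OF `𝒜₂` ALONG `π` IN THE SENSE OF THE MODULI FUNCTOR: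
a pair `(G, Ĝ)` with the six clauses of Def. 7.2–7.3 (level ∕ `X`, `X̂`, Poincaré, `λ`, `ι`) — ★ `TupleRelBaseChangeUnique` currency; an honest isomorphism
of group schemes over `X` would need ★ `exists_iso_of_tupleRel_id`, stated over a PRECONNECTED base.  This file removes the detour: the relation is read at
the point (★ `exists_tupleIsoVia_of_tupleRel`), symmetrised and rigidified THERE (★ `exists_tupleRel_id_symm`, ★ `exists_iso_of_tupleRel_id` over `Spec Ω`,
which IS connected), and FILE 1's transport runs from the point isomorphism.

THE MATHEMATICS ([MumfordFogartyKirwan1994] Ch. 6 §1 Cor. 6.8, Ch. 7 §2 Def. 7.2–7.3, §3; [GortzWedhorn2020] (4.7), (4.15)–(4.16), Prop. 4.16; [Shimura1998]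
§13.1 Thm. 1 ∕ §18.6): as in FILE 1, with the global isomorphism replaced by the moduli relation.

CONTENTS: §1 `coverKer_rows_readAt_of_isoAt_baseChange` — FILE 1 with the isomorphism given AT THE POINT `ℓ` (`Eℓ : ℬ ×_Y ℓ ≅ (𝒜₂ ×_{Y₂} π) ×_Y ℓ` exact on
`λ`, `ι`, basis sections); §2 `coverKer_rows_readAt_of_tupleRel_baseChange` — hypothesis = the GLOBAL six-clause relation «`ℬ` is a pull-back of `𝒜₂` along
`π` via `(G, Ĝ)`» (the `h` of ★ `exists_tupleIsoVia_of_tupleRel` VERBATIM at `(𝒜₁, 𝒜₂) := (𝒜₂, ℬ)`), conclusion = the SEVEN point rows `𝒜_ℓ → (𝒜₂)_{ℓ ≫ π}`.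
USE (Lines `F0P6aGlobalSheetRows.coverKerBody_sheet_of_global_rel`, LA4-p01 (g3)): `Y = Y₂ := X`, `𝒜 = 𝒜₂ := P.A`, `π := GaloisDescent.gal Fᵢ Sh_K γ⁻¹`.

References (metadata in `HarnessLib/References.lean`):
* [MumfordFogartyKirwan1994] D. Mumford, J. Fogarty, F. Kirwan, *Geometric Invariant Theory*, 3rd ed. (1994), Ch. 6 §1 Cor. 6.8 (p. 118); Ch. 7 §2 Def. 7.2 (p. 129), Def. 7.3 (p. 130); Ch. 7 §3 (pp. 134–139).
* [GortzWedhorn2020] U. Görtz, T. Wedhorn, *Algebraic Geometry I*, 2nd ed. (2020), Section (4.7) (pp. 107–108), (4.15)–(4.16) (pp. 116–117), Prop. 4.16 (p. 101).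
* [Shimura1998] G. Shimura, *Abelian Varieties with Complex Multiplication and Modular Functions* (1998), §13.1 Theorem 1 (pp. 97–99), §18.6 (pp. 124–127).
-/

set_option autoImplicit false

noncomputable section

-- Mathlib's `Over`/pull-back API is stated across semireducible wrappers (as in the ★ `AbelianSchemes/*` files).
set_option backward.isDefEq.respectTransparency false

universe u

open CategoryTheory CategoryTheory.Limits AlgebraicGeometry MonoidalCategory
open scoped MonObj Obj

namespace Literature.AlgebraicGeometry.AbelianSchemes

namespace AbelianSchemeOver

open Literature.AlgebraicGeometry.Motives (AlgPoints specOver)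

section RowsAtPointOfIsoAtBaseChange

variable {Y Y₂ : Scheme.{u}} {𝒜 ℬ : AbelianSchemeOver Y} {𝒜₂ : AbelianSchemeOver Y₂} {O : Type*} [CommRing O]
  (ρ𝒜 : RingAction O 𝒜) (ρℬ : RingAction O ℬ) (ρ₂ : RingAction O 𝒜₂) (D𝒜 : 𝒜.DualPair) (Dℬ : ℬ.DualPair) (D₂ : 𝒜₂.DualPair)
  (hD𝒜 : Nonempty ((Scheme.Modules.pullback D𝒜.unitHatSlice).obj D𝒜.P ≅ SheafOfModules.unit _))
  (hDℬ : Nonempty ((Scheme.Modules.pullback Dℬ.unitHatSlice).obj Dℬ.P ≅ SheafOfModules.unit _))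
  (hD₂ : Nonempty ((Scheme.Modules.pullback D₂.unitHatSlice).obj D₂.P ≅ SheafOfModules.unit _))
  (pol𝒜 : 𝒜.Polarization D𝒜) (polℬ : ℬ.Polarization Dℬ) (pol₂ : 𝒜₂.Polarization D₂)
  {g n : ℕ} (lvl𝒜 : 𝒜.LevelStructure g n) (lvlℬ : ℬ.LevelStructure g n) (lvl₂ : 𝒜₂.LevelStructure g n)
  (𝔞 𝔟 : O → Prop) (ν : O) (N : ℕ) (c : 𝒜.X ⟶ ℬ.X) [IsMonHom c] (π : Y ⟶ Y₂)
  {Ω : Type u} [Field Ω] (ℓ : Spec (.of Ω) ⟶ Y)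

include hD𝒜 hDℬ hD₂ in
/-- §1 **FILE 1 WITH THE ISOMORPHISM GIVEN AT THE POINT.**  The GLOBAL rows (t1)(t1′)(t2)(t3)(t4)(t5) of `c : 𝒜 → ℬ` over `Y`, and an isomorphism of group
schemes over `Spec Ω`, `Eℓ : ℬ ×_Y ℓ ≅ (𝒜₂ ×_{Y₂} π) ×_Y ℓ`, exact on the pulled-back polarisations (dual-homomorphism form), actions and basis sections,
give the SEVEN point rows `𝒜 ×_Y ℓ → 𝒜₂ ×_{Y₂} (ℓ ≫ π)` (proof = FILE 1's from step (B) on: ★ `coverKer_rows_readAt`, ★ `coverKer_transport_along_iso` twice,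
★ `exists_iso_of_tupleRel_id` ∘ ★ `tupleRel_baseChangeCompGrpIso_inv`). [cite: MumfordFogartyKirwan1994, Ch. 6 §1 Corollary 6.8 (p. 118) and Ch. 7 §2 Definition 7.2 (p. 129), Definition 7.3 (p. 130)]
[cite: GortzWedhorn2020, Section (4.7) (pp. 107–108) and (4.15) (p. 116)] [cite: Shimura1998, §13.1 Theorem 1 (pp. 97–99); §18.6 (pp. 124–127)] -/
theorem coverKer_rows_readAt_of_isoAt_baseChange
    (t1 : ∀ a, 𝔞 a → ∃ d : ℬ.X ⟶ 𝒜.X, c ≫ d = ρ𝒜.i a ∧ d ≫ c = ρℬ.i a)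
    (t1' : ∀ ⦃T : Over Y⦄ (t : T ⟶ 𝒜.X), t ≫ c = 1 ↔ ∀ a, 𝔞 a → t ≫ ρ𝒜.i a = 1)
    (t2 : ∀ b, 𝔟 b → ∃ f : 𝒜.X ⟶ ℬ.X, c ≫ ρℬ.i b = f ≫ ρℬ.i ν)
    (t3 : c ≫ polℬ.lam ≫ DualPair.dualIsogenyOver c D𝒜 Dℬ = pol𝒜.lam ≫ D𝒜.hat.mulN N)
    (t4 : ∀ a, ρ𝒜.i a ≫ c = c ≫ ρℬ.i a)
    (t5 : ∀ i, lvlℬ.σ i = lvl𝒜.σ i ≫ c)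
    (Eℓ : (ℬ.baseChange ℓ).X ≅ ((𝒜₂.baseChange π).baseChange ℓ).X) (hEℓmon : IsMonHom Eℓ.hom)
    (hEℓlam : Eℓ.hom ≫ ((pol₂.baseChange π).baseChange ℓ).lam ≫
      DualPair.dualIsogenyOver Eℓ.hom (Dℬ.baseChange ℓ) ((D₂.baseChange π).baseChange ℓ) = (polℬ.baseChange ℓ).lam)
    (hEℓact : ∀ a, baseChangeHom (ρℬ.i a) ℓ ≫ Eℓ.hom = Eℓ.hom ≫ baseChangeHom (baseChangeHom (ρ₂.i a) π) ℓ)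
    (hEℓsec : ∀ i, (lvlℬ.baseChange ℓ).σ i ≫ Eℓ.hom = ((lvl₂.baseChange π).baseChange ℓ).σ i) :
    ∃ (cℓ : (𝒜.baseChange ℓ).X ⟶ (𝒜₂.baseChange (ℓ ≫ π)).X) (_ : IsMonHom cℓ),
        (∀ a, 𝔞 a → ∃ d : (𝒜₂.baseChange (ℓ ≫ π)).X ⟶ (𝒜.baseChange ℓ).X,
          cℓ ≫ d = baseChangeHom (ρ𝒜.i a) ℓ ∧ d ≫ cℓ = baseChangeHom (ρ₂.i a) (ℓ ≫ π)) ∧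
        (∀ ⦃T : Literature.AlgebraicGeometry.Motives.SchemeOver Ω⦄ (t : T ⟶ (𝒜.baseChange ℓ).X),
          t ≫ cℓ = 1 ↔ ∀ a, 𝔞 a → t ≫ baseChangeHom (ρ𝒜.i a) ℓ = 1) ∧
        (∀ b, 𝔟 b → ∃ f : (𝒜.baseChange ℓ).X ⟶ (𝒜₂.baseChange (ℓ ≫ π)).X,
          cℓ ≫ baseChangeHom (ρ₂.i b) (ℓ ≫ π) = f ≫ baseChangeHom (ρ₂.i ν) (ℓ ≫ π)) ∧
        cℓ ≫ (pol₂.baseChange (ℓ ≫ π)).lam ≫ DualPair.dualIsogenyOver cℓ (D𝒜.baseChange ℓ) (D₂.baseChange (ℓ ≫ π)) =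
          (pol𝒜.baseChange ℓ).lam ≫ (D𝒜.baseChange ℓ).hat.mulN N ∧
        (∀ a, baseChangeHom (ρ𝒜.i a) ℓ ≫ cℓ = cℓ ≫ baseChangeHom (ρ₂.i a) (ℓ ≫ π)) ∧
        (∀ a : Fin g ⊕ Fin g → ZMod n,
          (AlgPoints.map cℓ (𝒜.restrictPt ℓ (lvl𝒜.section_ a)) : (𝒜₂.baseChange (ℓ ≫ π)).toAffine.toAbelianVariety.Points Ω) =
            𝒜₂.restrictPt (ℓ ≫ π) (lvl₂.section_ a)) := by
  classical
  -- (A) the global rows of `c`, read at `ℓ`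
  have hA := coverKer_rows_readAt ρ𝒜 ρℬ D𝒜 Dℬ pol𝒜 polℬ lvl𝒜 lvlℬ 𝔞 𝔟 ν N c ℓ t1 t1' t2 t3 t4 t5
  -- the Poincaré pins of all the base-changed dual pairs
  have h𝒜ℓ := DualPair.nonempty_unitHatSlice_baseChange_iso (g := ℓ) D𝒜 hD𝒜
  have hℬℓ := DualPair.nonempty_unitHatSlice_baseChange_iso (g := ℓ) Dℬ hDℬ
  have h₂πℓ := DualPair.nonempty_unitHatSlice_baseChange_iso (g := ℓ) (D₂.baseChange π) (DualPair.nonempty_unitHatSlice_baseChange_iso (g := π) D₂ hD₂)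
  have h₂ℓπ := DualPair.nonempty_unitHatSlice_baseChange_iso (g := ℓ ≫ π) D₂ hD₂
  -- the identity side's bookkeeping (`e := Iso.refl`: `(𝟙)^∨ = 𝟙`, `AlgPoints.map 𝟙 = id`)
  haveI : IsMonHom (Iso.refl (𝒜.baseChange ℓ).X).hom := (inferInstance : IsMonHom (𝟙 _))
  have h1 : DualPair.dualIsogenyOver (Iso.refl (𝒜.baseChange ℓ).X).hom (D𝒜.baseChange ℓ) (D𝒜.baseChange ℓ) = 𝟙 _ :=
    (DualPair.dualIsogenyOver_congr (D𝒜.baseChange ℓ) (D𝒜.baseChange ℓ) (ψ₁ := (Iso.refl (𝒜.baseChange ℓ).X).hom) (ψ₂ := 𝟙 _) (Iso.refl_hom _)).trans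
      (DualPair.dualIsogenyOver_id' (D𝒜.baseChange ℓ) h𝒜ℓ)
  have hrefl : (Iso.refl (𝒜.baseChange ℓ).X).hom ≫ (pol𝒜.baseChange ℓ).lam ≫
      DualPair.dualIsogenyOver (Iso.refl (𝒜.baseChange ℓ).X).hom (D𝒜.baseChange ℓ) (D𝒜.baseChange ℓ) = (pol𝒜.baseChange ℓ).lam := by
    rw [h1, Category.comp_id, Iso.refl_hom, Category.id_comp]
  -- (B) the exact isomorphism AT `ℓ` carries the level points
  haveI := hEℓmon
  have hEℓpt : ∀ a : Fin g ⊕ Fin g → ZMod n,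
      (AlgPoints.map Eℓ.hom (ℬ.restrictPt ℓ (lvlℬ.section_ a)) : ((𝒜₂.baseChange π).baseChange ℓ).toAffine.toAbelianVariety.Points Ω) =
        (𝒜₂.baseChange π).restrictPt ℓ ((lvl₂.baseChange π).section_ a) := fun a =>
    map_restrictPt_section_eq_of_baseChange_σ_comp ℓ lvlℬ (lvl₂.baseChange π) Eℓ.hom hEℓsec a
  have hB := coverKer_transport_along_iso (D𝒜.baseChange ℓ) (D𝒜.baseChange ℓ) (Dℬ.baseChange ℓ) ((D₂.baseChange π).baseChange ℓ)
    h𝒜ℓ h𝒜ℓ hℬℓ h₂πℓ (pol𝒜.baseChange ℓ).lam (pol𝒜.baseChange ℓ).lam (polℬ.baseChange ℓ).lam ((pol₂.baseChange π).baseChange ℓ).lam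
    (fun a => baseChangeHom (ρ𝒜.i a) ℓ) (fun a => baseChangeHom (ρ𝒜.i a) ℓ)
    (fun a => baseChangeHom (ρℬ.i a) ℓ) (fun a => baseChangeHom (baseChangeHom (ρ₂.i a) π) ℓ)
    (fun a : Fin g ⊕ Fin g → ZMod n => (𝒜.restrictPt ℓ (lvl𝒜.section_ a) : (𝒜.baseChange ℓ).toAffine.toAbelianVariety.Points Ω))
    (fun a : Fin g ⊕ Fin g → ZMod n => (𝒜.restrictPt ℓ (lvl𝒜.section_ a) : (𝒜.baseChange ℓ).toAffine.toAbelianVariety.Points Ω))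
    (fun a : Fin g ⊕ Fin g → ZMod n => (ℬ.restrictPt ℓ (lvlℬ.section_ a) : (ℬ.baseChange ℓ).toAffine.toAbelianVariety.Points Ω))
    (fun a : Fin g ⊕ Fin g → ZMod n =>
      ((𝒜₂.baseChange π).restrictPt ℓ ((lvl₂.baseChange π).section_ a) : ((𝒜₂.baseChange π).baseChange ℓ).toAffine.toAbelianVariety.Points Ω))
    𝔞 𝔟 ν (Iso.refl _) Eℓ N
    hrefl
    hEℓlam (fun a => by simp only [Iso.refl_hom, Category.id_comp, Category.comp_id]) hEℓact
    (fun a => by rw [Iso.refl_hom, AlgPoints.map_id]; rfl) hEℓpt hA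
  -- (C) the exact comparison isomorphism `(𝒜₂ ×_{Y₂} π) ×_Y ℓ ≅ 𝒜₂ ×_{Y₂} (ℓ ≫ π)`
  obtain ⟨e, hemon, -, -, helam, hesec, heact⟩ := exists_iso_of_tupleRel_id ((D₂.baseChange π).baseChange ℓ) (D₂.baseChange (ℓ ≫ π))
    (baseChangeHom (pol₂.baseChange π).lam ℓ) (pol₂.baseChange (ℓ ≫ π)).lam h₂ℓπ ((lvl₂.baseChange π).baseChange ℓ) (lvl₂.baseChange (ℓ ≫ π))
    (fun a => baseChangeHom (baseChangeHom (ρ₂.i a) π) ℓ) (fun a => baseChangeHom (ρ₂.i a) (ℓ ≫ π))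
    (tupleRel_baseChangeCompGrpIso_inv 𝒜₂ ρ₂ D₂ pol₂ lvl₂ π ℓ)
  haveI := hemon
  have hept : ∀ a : Fin g ⊕ Fin g → ZMod n,
      (AlgPoints.map e.hom ((𝒜₂.baseChange π).restrictPt ℓ ((lvl₂.baseChange π).section_ a)) :
          (𝒜₂.baseChange (ℓ ≫ π)).toAffine.toAbelianVariety.Points Ω) = 𝒜₂.restrictPt (ℓ ≫ π) (lvl₂.section_ a) := fun a =>
    map_restrictPt_section_eq_of_baseChange_σ_comp₂ ℓ (ℓ ≫ π) (𝒜₂.baseChange π) 𝒜₂ (lvl₂.baseChange π) lvl₂ e.hom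
      (fun i => by rw [LevelStructure.baseChange_σ, LevelStructure.baseChange_σ]; exact hesec i) a
  exact coverKer_transport_along_iso (D𝒜.baseChange ℓ) (D𝒜.baseChange ℓ) ((D₂.baseChange π).baseChange ℓ) (D₂.baseChange (ℓ ≫ π))
    h𝒜ℓ h𝒜ℓ h₂πℓ h₂ℓπ (pol𝒜.baseChange ℓ).lam (pol𝒜.baseChange ℓ).lam ((pol₂.baseChange π).baseChange ℓ).lam (pol₂.baseChange (ℓ ≫ π)).lam
    (fun a => baseChangeHom (ρ𝒜.i a) ℓ) (fun a => baseChangeHom (ρ𝒜.i a) ℓ)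
    (fun a => baseChangeHom (baseChangeHom (ρ₂.i a) π) ℓ) (fun a => baseChangeHom (ρ₂.i a) (ℓ ≫ π))
    (fun a : Fin g ⊕ Fin g → ZMod n => (𝒜.restrictPt ℓ (lvl𝒜.section_ a) : (𝒜.baseChange ℓ).toAffine.toAbelianVariety.Points Ω))
    (fun a : Fin g ⊕ Fin g → ZMod n => (𝒜.restrictPt ℓ (lvl𝒜.section_ a) : (𝒜.baseChange ℓ).toAffine.toAbelianVariety.Points Ω))
    (fun a : Fin g ⊕ Fin g → ZMod n =>
      ((𝒜₂.baseChange π).restrictPt ℓ ((lvl₂.baseChange π).section_ a) : ((𝒜₂.baseChange π).baseChange ℓ).toAffine.toAbelianVariety.Points Ω))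
    (fun a : Fin g ⊕ Fin g → ZMod n => (𝒜₂.restrictPt (ℓ ≫ π) (lvl₂.section_ a) : (𝒜₂.baseChange (ℓ ≫ π)).toAffine.toAbelianVariety.Points Ω))
    𝔞 𝔟 ν (Iso.refl _) e N
    hrefl
    helam (fun a => by simp only [Iso.refl_hom, Category.id_comp, Category.comp_id]) heact
    (fun a => by rw [Iso.refl_hom, AlgPoints.map_id]; rfl) hept hB

end RowsAtPointOfIsoAtBaseChange

section RowsAtPointOfTupleRelBaseChange

variable {Y Y₂ : Scheme.{u}} {𝒜 ℬ : AbelianSchemeOver Y} {𝒜₂ : AbelianSchemeOver Y₂} {O : Type*} [CommRing O]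
  (ρ𝒜 : RingAction O 𝒜) (ρℬ : RingAction O ℬ) (ρ₂ : RingAction O 𝒜₂) (D𝒜 : 𝒜.DualPair) (Dℬ : ℬ.DualPair) (D₂ : 𝒜₂.DualPair)
  (hD𝒜 : Nonempty ((Scheme.Modules.pullback D𝒜.unitHatSlice).obj D𝒜.P ≅ SheafOfModules.unit _))
  (hDℬ : Nonempty ((Scheme.Modules.pullback Dℬ.unitHatSlice).obj Dℬ.P ≅ SheafOfModules.unit _))
  (hD₂ : Nonempty ((Scheme.Modules.pullback D₂.unitHatSlice).obj D₂.P ≅ SheafOfModules.unit _))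
  (pol𝒜 : 𝒜.Polarization D𝒜) (polℬ : ℬ.Polarization Dℬ) (pol₂ : 𝒜₂.Polarization D₂)
  {g n : ℕ} (lvl𝒜 : 𝒜.LevelStructure g n) (lvlℬ : ℬ.LevelStructure g n) (lvl₂ : 𝒜₂.LevelStructure g n)
  (𝔞 𝔟 : O → Prop) (ν : O) (N : ℕ) (c : 𝒜.X ⟶ ℬ.X) [IsMonHom c] (π : Y ⟶ Y₂)
  {G : ℬ.X.left ⟶ 𝒜₂.X.left} {Ĝ : Dℬ.hat.X.left ⟶ D₂.hat.X.left}
  {Ω : Type u} [Field Ω] (ℓ : Spec (.of Ω) ⟶ Y)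

include hD𝒜 hDℬ hD₂ in
/-- §2 **THE GLOBAL SERRE-COVER ROWS THROUGH A GLOBAL MODULI RELATION, READ AT A FIELD POINT.**  Let `c : 𝒜 → ℬ` be a homomorphism of abelian schemes over
`Y` with the GLOBAL rows (t1)(t1′)(t2)(t3)(t4)(t5), and let `(ℬ, ιℬ, (ℬ̂, 𝒫ℬ), λℬ, lvlℬ)` BE A PULL-BACK OF `(𝒜₂, ι₂, (Â₂, 𝒫₂), λ₂, lvl₂)` ALONG `π : Y → Y₂` via
`(G, Ĝ)` — the six clauses of [MumfordFogartyKirwan1994] Def. 7.2–7.3 (level ∕ `X`, `X̂`, Poincaré `(G × Ĝ)^*𝒫₂ ≅ 𝒫ℬ`, `λℬ ≫ Ĝ = G ≫ λ₂`, `ιℬ(a) ≫ G = G ≫ ι₂(a)`),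
NO isomorphism over `Y` and NO connectedness of `Y` assumed.  Then at every field point `ℓ : Spec Ω → Y` there is a homomorphism `𝒜 ×_Y ℓ → 𝒜₂ ×_{Y₂} (ℓ ≫ π)`
with the SEVEN point rows (kernel clause included).  Proof: ★ `exists_tupleIsoVia_of_tupleRel` reads the relation at `ℓ`; over `Spec Ω` (reduced, Noetherian,
connected) ★ `exists_tupleRel_id_symm` and ★ `exists_iso_of_tupleRel_id` turn it into an exact isomorphism `ℬ ×_Y ℓ ≅ (𝒜₂ ×_{Y₂} π) ×_Y ℓ`; then §1.
[cite: MumfordFogartyKirwan1994, Ch. 7 §2 Definition 7.2 (p. 129), Definition 7.3 (p. 130) and Ch. 7 §3 (pp. 134–139)] [cite: GortzWedhorn2020, Prop. 4.16 (p. 101) and Section (4.7) (pp. 107–108)]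
[cite: Shimura1998, §13.1 Theorem 1 (pp. 97–99); §18.6 (pp. 124–127)] -/
theorem coverKer_rows_readAt_of_tupleRel_baseChange
    (t1 : ∀ a, 𝔞 a → ∃ d : ℬ.X ⟶ 𝒜.X, c ≫ d = ρ𝒜.i a ∧ d ≫ c = ρℬ.i a)
    (t1' : ∀ ⦃T : Over Y⦄ (t : T ⟶ 𝒜.X), t ≫ c = 1 ↔ ∀ a, 𝔞 a → t ≫ ρ𝒜.i a = 1)
    (t2 : ∀ b, 𝔟 b → ∃ f : 𝒜.X ⟶ ℬ.X, c ≫ ρℬ.i b = f ≫ ρℬ.i ν)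
    (t3 : c ≫ polℬ.lam ≫ DualPair.dualIsogenyOver c D𝒜 Dℬ = pol𝒜.lam ≫ D𝒜.hat.mulN N)
    (t4 : ∀ a, ρ𝒜.i a ≫ c = c ≫ ρℬ.i a)
    (t5 : ∀ i, lvlℬ.σ i = lvl𝒜.σ i ≫ c)
    (hrel : lvlℬ.IsBaseChangeVia lvl₂ π G ∧ Dℬ.hat.IsBaseChangeVia D₂.hat π Ĝ ∧
      (∃ (wG : ℬ.X.hom ≫ π = G ≫ 𝒜₂.X.hom) (wĜ : Dℬ.hat.X.hom ≫ π = Ĝ ≫ D₂.hat.X.hom),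
        Nonempty ((Scheme.Modules.pullback
          (pullback.map ℬ.X.hom Dℬ.hat.X.hom 𝒜₂.X.hom D₂.hat.X.hom G Ĝ π wG wĜ)).obj D₂.P ≅ Dℬ.P)) ∧
      polℬ.lam.left ≫ Ĝ = G ≫ pol₂.lam.left ∧ ∀ a : O, (ρℬ.i a).left ≫ G = G ≫ (ρ₂.i a).left) :
    ∃ (cℓ : (𝒜.baseChange ℓ).X ⟶ (𝒜₂.baseChange (ℓ ≫ π)).X) (_ : IsMonHom cℓ),
        (∀ a, 𝔞 a → ∃ d : (𝒜₂.baseChange (ℓ ≫ π)).X ⟶ (𝒜.baseChange ℓ).X,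
          cℓ ≫ d = baseChangeHom (ρ𝒜.i a) ℓ ∧ d ≫ cℓ = baseChangeHom (ρ₂.i a) (ℓ ≫ π)) ∧
        (∀ ⦃T : Literature.AlgebraicGeometry.Motives.SchemeOver Ω⦄ (t : T ⟶ (𝒜.baseChange ℓ).X),
          t ≫ cℓ = 1 ↔ ∀ a, 𝔞 a → t ≫ baseChangeHom (ρ𝒜.i a) ℓ = 1) ∧
        (∀ b, 𝔟 b → ∃ f : (𝒜.baseChange ℓ).X ⟶ (𝒜₂.baseChange (ℓ ≫ π)).X,
          cℓ ≫ baseChangeHom (ρ₂.i b) (ℓ ≫ π) = f ≫ baseChangeHom (ρ₂.i ν) (ℓ ≫ π)) ∧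
        cℓ ≫ (pol₂.baseChange (ℓ ≫ π)).lam ≫ DualPair.dualIsogenyOver cℓ (D𝒜.baseChange ℓ) (D₂.baseChange (ℓ ≫ π)) =
          (pol𝒜.baseChange ℓ).lam ≫ (D𝒜.baseChange ℓ).hat.mulN N ∧
        (∀ a, baseChangeHom (ρ𝒜.i a) ℓ ≫ cℓ = cℓ ≫ baseChangeHom (ρ₂.i a) (ℓ ≫ π)) ∧
        (∀ a : Fin g ⊕ Fin g → ZMod n,
          (AlgPoints.map cℓ (𝒜.restrictPt ℓ (lvl𝒜.section_ a)) : (𝒜₂.baseChange (ℓ ≫ π)).toAffine.toAbelianVariety.Points Ω) =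
            𝒜₂.restrictPt (ℓ ≫ π) (lvl₂.section_ a)) := by
  classical
  -- the relation read at `ℓ`: six clauses along `𝟙 (Spec Ω)` from `(𝒜₂ ×_{Y₂} π) ×_Y ℓ` to `ℬ ×_Y ℓ`
  obtain ⟨G', Ĝ', h'⟩ := exists_tupleIsoVia_of_tupleRel 𝒜₂ ρ₂ D₂ pol₂ lvl₂ ℬ ρℬ Dℬ polℬ lvlℬ π hrel ℓ
  -- the Poincaré pins at the point
  have hℬℓ := DualPair.nonempty_unitHatSlice_baseChange_iso (g := ℓ) Dℬ hDℬ
  have h₂πℓ := DualPair.nonempty_unitHatSlice_baseChange_iso (g := ℓ) (D₂.baseChange π) (DualPair.nonempty_unitHatSlice_baseChange_iso (g := π) D₂ hD₂)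
  -- symmetrise over the (connected) point and rigidify to an exact isomorphism `ℬ ×_Y ℓ ≅ (𝒜₂ ×_{Y₂} π) ×_Y ℓ`
  haveI := ((pol₂.baseChange π).baseChange ℓ).isMonHom
  obtain ⟨G'', Ĝ'', h''⟩ := exists_tupleRel_id_symm ((D₂.baseChange π).baseChange ℓ) (Dℬ.baseChange ℓ)
    ((pol₂.baseChange π).baseChange ℓ).lam (polℬ.baseChange ℓ).lam h₂πℓ hℬℓ ((lvl₂.baseChange π).baseChange ℓ) (lvlℬ.baseChange ℓ)
    (fun a => baseChangeHom ((ρ₂.baseChange π).i a) ℓ) (fun a => baseChangeHom (ρℬ.i a) ℓ) h'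
  obtain ⟨e, hemon, -, -, helam, hesec, heact⟩ := exists_iso_of_tupleRel_id (Dℬ.baseChange ℓ) ((D₂.baseChange π).baseChange ℓ)
    (polℬ.baseChange ℓ).lam ((pol₂.baseChange π).baseChange ℓ).lam h₂πℓ (lvlℬ.baseChange ℓ) ((lvl₂.baseChange π).baseChange ℓ)
    (fun a => baseChangeHom (ρℬ.i a) ℓ) (fun a => baseChangeHom ((ρ₂.baseChange π).i a) ℓ) h''
  exact coverKer_rows_readAt_of_isoAt_baseChange ρ𝒜 ρℬ ρ₂ D𝒜 Dℬ D₂ hD𝒜 hDℬ hD₂ pol𝒜 polℬ pol₂ lvl𝒜 lvlℬ lvl₂ 𝔞 𝔟 ν N c π ℓ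
    t1 t1' t2 t3 t4 t5 e hemon helam heact hesec

end RowsAtPointOfTupleRelBaseChange

end AbelianSchemeOver

end Literature.AlgebraicGeometry.AbelianSchemes

end
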